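import Mathlib
import HarnessLib
import Summits.PneNP.Statement
import Literature.Computability.Complexity.Promise
import Literature.Computability.Complexity.PolyHierarchy

/-!
# PneNP / SzkEntropy — the assembly (stmt-PneNP-13910), route-independent proof

Route `PneNP/SzkEntropy`, assembly item stmt-PneNP-13910 (rev-3 re-filing of the proved
stmt-PneNP-10782):

  `PeaThreeNotInP → PeaMemPH → PhCollapse → CookModelBridge → PneNP`,

the deciding chain over the route's own decls (identical to the type of the route file's certified
deciding theorem `closes`): if `¬ PneNP` then `NP ⊆ P` in Cook's Clay model, hence — by the model
bridge — `Nondeterministic.NP ⊆ Classes.P`, hence `PH ⊆ P` (`PhCollapse`), hence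
`promiseLift PH ⊆ promiseLift P = PromiseP` (`promiseLift_mono`), and `PEA_3 ∈ promiseLift PH`
(`PeaMemPH` at `d = 3`) lands in `PromiseP`, contradicting X = `PeaThreeNotInP`.

This file deliberately imports NEITHER the route file `Summits.PneNP.PneNP.Theses.SzkEntropy` NOR any
`Theorems/SzkEntropy*.lean`: the earlier proof `szkEntropy_assembly_proof` (`exact closes`) imports
the route file, and the gate links a proved item by importing the proving module INTO the route
file, which closed an import cycle (route rev 3, 2026-08-15).  Following the planner's instruction in
the item's docstring, the four hypotheses are therefore PASTED structurally (the `let ev/H/PEA := …`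
bodies of `PeaThreeNotInP` and `PeaMemPH` verbatim up to the name of one unused binder, then the
bodies of `PhCollapse` and `CookModelBridge`) and the five-line proof of `closes` is repeated.

References: Z. Dvir, D. Gutfreund, G. N. Rothblum, S. Vadhan, *On approximating the entropy of
polynomial mappings*, ICS 2011, Thm 1.1; S. Arora, B. Barak, *Computational Complexity: A Modern
Approach* (2009), Thm 5.4; O. Goldreich, *On promise problems* (2006), Def. 1.2.
-/

namespace Summit.PneNP.PneNP.Theorems

/-- **The assembly of route SzkEntropy** (item stmt-PneNP-13910; same term as stmt-PneNP-10782 and as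
the type of the route's deciding theorem `closes`): thesis X (`PEA_3 ∉ PromiseP`), `PEA_d ∈
promiseLift PH` for all `d`, the collapse `NP ⊆ P → PH ⊆ P` and the Cook-model bridge together give
`PneNP`.  Proof: if `¬ PneNP`, every `L ∈ NP` (Cook's model, transported by the bridge) is in `P`, so
`PH ⊆ P`, so `promiseLift PH ⊆ PromiseP` (`promiseLift_mono`) contains `PEA_3`, contradicting X.
[DvirGutfreundRothblumVadhan2010, Thm 1.1; AroraBarakCC2009, Thm 5.4; Goldreich2006, Def. 1.2] -/
theorem szkEntropy_assembly_standalone :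
    (let ev : (n : ℕ) → List (List (List (Fin n))) → (Fin n → ZMod 2) → List (ZMod 2) := fun _ P x => P.map fun p => (p.map fun μ => (μ.map x).prod).sum; let H : (Σ n : ℕ, List (List (List (Fin n))) × ℕ) → ℝ := fun I => (∑ x : Fin I.1 → ZMod 2, Real.logb 2 (((Finset.univ : Finset (Fin I.1 → ZMod 2)).card : ℝ) / (Finset.univ.filter fun x' : Fin I.1 → ZMod 2 => ev I.1 I.2.1 x' = ev I.1 I.2.1 x).card)) / (Finset.univ : Finset (Fin I.1 → ZMod 2)).card; let PEA : ℕ → Literature.Computability.Complexity.PromiseProblem := fun d => Literature.Computability.Complexity.PromiseProblem.ofEncoding (Computability.Encoding.sigmaBool fun n => ((Literature.Computability.Complexity.encodingFinBool n).listBool.listBool.listBool).pairBool Computability.encodingNatBool) {I : (Σ n : ℕ, List (List (List (Fin n))) × ℕ) | (∀ p ∈ I.2.1, ∀ μ ∈ p, μ.length ≤ d) ∧ (I.2.2 : ℝ) + 1 ≤ H I} {I : (Σ n : ℕ, List (List (List (Fin n))) × ℕ) | (∀ p ∈ I.2.1, ∀ μ ∈ p, μ.length ≤ d) ∧ H I ≤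 (I.2.2 : ℝ)}; PEA 3 ∉ Literature.Computability.Complexity.PromiseP) →
    (let ev : (n : ℕ) → List (List (List (Fin n))) → (Fin n → ZMod 2) → List (ZMod 2) := fun _ P x => P.map fun p => (p.map fun μ => (μ.map x).prod).sum; let H : (Σ n : ℕ, List (List (List (Fin n))) × ℕ) → ℝ := fun I => (∑ x : Fin I.1 → ZMod 2, Real.logb 2 (((Finset.univ : Finset (Fin I.1 → ZMod 2)).card : ℝ) / (Finset.univ.filter fun x' : Fin I.1 → ZMod 2 => ev I.1 I.2.1 x' = ev I.1 I.2.1 x).card)) / (Finset.univ : Finset (Fin I.1 → ZMod 2)).card; let PEA : ℕ → Literature.Computability.Complexity.PromiseProblem := fun d => Literature.Computability.Complexity.PromiseProblem.ofEncoding (Computability.Encoding.sigmaBool fun n => ((Literature.Computability.Complexity.encodingFinBool n).listBool.listBool.listBool).pairBool Computability.encodingNatBool) {I : (Σ n : ℕ, List (List (List (Fin n))) × ℕ) | (∀ p ∈ I.2.1, ∀ μ ∈ p, μ.length ≤ d) ∧ (I.2.2 : ℝ) + 1 ≤ H I} {I : (Σ n : ℕ, List (List (List (Fin n))) × ℕ)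 | (∀ p ∈ I.2.1, ∀ μ ∈ p, μ.length ≤ d) ∧ H I ≤ (I.2.2 : ℝ)}; ∀ d : ℕ, PEA d ∈ Literature.Computability.Complexity.promiseLift Literature.Computability.Complexity.PH) →
    ((Literature.Computability.Complexity.Nondeterministic.NP ⊆ Literature.Computability.Complexity.Classes.P) → (Literature.Computability.Complexity.PH ⊆ Literature.Computability.Complexity.Classes.P)) →
    (And (Literature.Computability.Complexity.PNPWave0.P Bool = Literature.Computability.Complexity.Classes.P) (Literature.Computability.Complexity.PNPWave0.NP Bool = Literature.Computability.Complexity.Nondeterministic.NP)) →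
    _root_.PneNP := by
  intro hX hPH hC hB
  by_contra hne
  refine hX (Literature.Computability.Complexity.promiseLift_mono (hC ?_) (hPH 3))
  intro L hL
  by_contra hLP
  exact hne ⟨L, hB.2 ▸ hL, fun h => hLP (hB.1 ▸ h)⟩

end Summit.PneNP.PneNP.Theorems
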